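import Summits.BirchSwinnertonDyer.BirchSwinnertonDyer.Theorems.AlignedTransportAtTwoMainConjectureTransportAlignedAtTwoDeltaPosCongruenceInputs
import Summits.BirchSwinnertonDyer.BirchSwinnertonDyer.Theorems.AlignedTransportAtTwoMainConjectureTransportAlignedAtTwoKilfordCopyCrossLevelTools
import HarnessLib

/-!
# Crux C1 `MainConjectureTransportAlignedAtTwo` (stmt-BirchSwinnertonDyer-22296), line `birth`, residual (R2) `stub_lamLawKilford`, UNEQUAL conductors:
# THE INTERMEDIATE-LEVEL REDUCTION — for `N₂ = q·N₁` the cross-level same-kernel statement at the depleted level `N'` FOLLOWS from a fixed-level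
# same-kernel statement at level `N₂` between the old line `F₁ = f₁ + q·f₁(q·)` and `f₂` (width seat att-p3 g18; `--supports 22296`)

THEOREMS ONLY (no `def`, no `sorry`, no named fact). Pure period bookkeeping on top of `…KilfordCopyCrossLevelTools` and att-p1 g9's exact depleted
period formula `{∞, r}_g = (∏_{ℓ∈S} D_ℓ)·{∞, ·}_f (r)` (`…DepletedPeriodFormula.modularSymbol_depleted_eq_act_of_dvd`): nothing about Galois
representations, alignment, multiplicities or the main conjecture is used or asserted. BSD is not proved by this; C1 is not closed by this; the
cross-level input of (R2) is NOT discharged — it is REDUCED, for the conductor shape `N(W₂) = q·N(W₁)` (the shape of BOTH cell′ members: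
M2 `503c1 → 14587b1 = 29·503`, M3 `2071a1 → 6213a1 = 3·2071`), to a statement at the intermediate level `N₂`.

CONTEXT. After v26/v27 the residual (R2) of C1 at UNEQUAL conductors is ONE inline cross-level hypothesis (`hCopy` of
`…KilfordCopyOfPrint.lamLawKilford_of_facts`, v27 `stub_sameDepletedCopyKilfordNe`): «for the `S`-depleted forms `g₁ g₂` at `N' = N₁N₂∏ℓ²`,
`u₁(c₁·∏ℓ²·x(g₁)/2) = O ↔ u₂(c₂·∏ℓ²·x(g₂)/2) = O` for every cycle `x ∈ H₁(X₀(N');ℤ)`», untestable by the cell's engines (`N' ≈ 10⁹–10¹³`) and with no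
fixed-level mechanism (memo `Cruxes/…/SYMMETRIC-SOCLE-att-p3-g17.md` §4–§5). This file proves the REDUCTION proposed in that memo's §5 (2.):

* §1 **`oldLine_absorb`** — for ONE eigenform `f` good at `q` with `a_q(f)` EVEN: modulo `2Λ`, the depleted functional `c·∏ℓ²·{∞, γ∞}_g` equals
  `c·(Q̄·{∞,·}_F)(γ∞)` for the old line `F = f + q·f(q·)` and ANY integer operator `Q̄ = ∏_{ℓ∈S}([1] + B'_ℓ[ℓ] + E'_ℓ[ℓ²])` whose data are congruent
  to `f`'s Euler data off `q` and are «multiplicative» (`B'_q` odd, `E'_q = 0`) at `q` — because mod `2` the `q`-Euler factor of `f` is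
  `1 − a_qV_q + qV_q² ≡ (1 + V_q)²`.
* §2 **`sameKernel_depleted_of_sameKernel_oldLine`** (abstract lattices `Λᵢ ⊇ cᵢΛ_{fᵢ}`): for `N₂ = N₁q`, `a_q(f₁)` even, `a_q(f₂)` odd, `a_ℓ(f₁) ≡ a_ℓ(f₂)`
  on `S ∖ q`: same half-kernel of `(c₁·y(F₁), c₂·y(f₂))` on `H₁(X₀(N₂);ℤ)` ⟹ same half-kernel of the depleted functionals on `H₁(X₀(N');ℤ)` — both are
  `cᵢ·y(Hᵢ)` mod `2Λᵢ` for ONE cycle `y ∈ H₁(X₀(N₂);ℤ)` (`…Tools.exists_mem_periodHomology_apply_eq_act`).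
* §3 **`uniformize_depleted_iff_of_oldLine`** — the same in the crux's currency (`ModularParametrizationData`, `uniformize`, `W.LFunction`): its conclusion
  is VERBATIM the body of the inline cross-level hypothesis for the pair; its hypothesis «`u₁(c₁·y(F₁)/2) = O ↔ u₂(c₂·y(f₂)/2) = O` for all
  `y ∈ H₁(X₀(N₂);ℤ)`» is PLANE(2) at the intermediate level (the old `E₁`-plane `(α₁* + α_q*)E₁^∨[2]` and `E₂^∨[2]` have the same orthogonal in
  `J₀(N₂)[2]`) — a fixed-level statement testable at `N₂ ∈ {6213, 14587}` by the cell's exact engines, and H12♯-shaped (memo §5 (3.)).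
* §4 `odd_LFunction_of_conductorNorm_eq_mul`, `two_dvd_LFunction_sub_of_conductorNorm_eq_mul`, **`uniformize_depleted_iff_of_oldLine_conductor`**:
  at the conductor levels the parities `a_q(W₂)` odd and `a_ℓ(W₁) ≡ a_ℓ(W₂)` (`ℓ ∈ S ∖ q`) follow from `N(W₂) = N(W₁)·q` (reduction types); the
  ONE parity hypothesis left is `a_q(W₁)` even (Kraus–Oesterlé 1992 Prop. 3 second clause at `p = 2`, via the Tate curve; not in the tree).
References: Greenberg–Vatsal 2000 §3 [GreenbergVatsal2000]; Emerton–Pollack–Weston 2006 §3 (3.4)–(3.5) [EmertonPollackWeston2006]; Cremona 1997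
§2.4, §2.10 [CremonaAlgorithms1997]; Diamond–Shurman §5.7 [DiamondShurman2005]; Kraus–Oesterlé 1992 Prop. 3 [KrausOesterle1992]; Silverman ATAEC IV.10.2
[Silverman1994]; Wiese 2007 / Kilford–Wiese 2008 Question 1.9 (reading only) [Wiese2007Multiplicities] [KilfordWiese2008].
-/

noncomputable section

-- justification: the `Summit.BirchSwinnertonDyer.BirchSwinnertonDyer.…` path repeats a component (route-file convention)
set_option linter.dupNamespace false
set_option autoImplicit false

open scoped MatrixGroups ModularForm Classical

open CongruenceSubgroup Complex WeierstrassCurve IsDedekindDomain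
open Literature.NumberTheory.EllipticCurves Literature.NumberTheory.EllipticCurves.ModularForms
open Summit.BirchSwinnertonDyer.BirchSwinnertonDyer.Theorems.AlignedTransportAtTwoDeltaPosCongruenceInputs (odd_LFunction_iff_hasMultiplicativeReductionAtPrime)
open Summit.BirchSwinnertonDyer.BirchSwinnertonDyer.Theorems.ThetaLayerLambdaCongruenceAtTwo
open Summit.BirchSwinnertonDyer.BirchSwinnertonDyer.Theorems.AlignedTransportAtTwoDepletedPeriodFormula

namespace Summit.BirchSwinnertonDyer.BirchSwinnertonDyer.Theorems.AlignedTransportAtTwoKilfordCopyCrossLevel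

open Summit.BirchSwinnertonDyer.BirchSwinnertonDyer.Theorems.AlignedTransportAtTwoKilfordCopyCrossLevelTools

/-! ## §1 ABSORPTION: the `S`-depleted functional of `f` (good at `q`, `a_q(f)` even) through the `q`-old line `F = f + q·f(q·)`, modulo `2Λ` -/
/-- **Absorption of the `q`-old line.** `f ∈ S₂(Γ₀(N))` a Hecke eigenform with integer coefficients `A`, `q ∤ N` prime with `a_q(f)` EVEN,
`S ∋ q` a set of odd primes, `g` the `S`-depleted form at a level `N'` with `L∏_{ℓ∈S}ℓ² ∣ N'`, `F` the old line at level `L = Nq`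
(`a_n(F) = a_n(f) + q a_{n/q}(f)`), `Λ ⊇ c·Λ_f`. For ANY integer data `(B'_ℓ, E'_ℓ)_{ℓ∈S}` with `B'_ℓ ≡ -a_ℓ(f)`, `E'_ℓ ≡ 𝟙_{ℓ∤N} (mod 2)`
off `q` and `B'_q` ODD, `E'_q = 0` at `q` — i.e. the mod-`2` Euler data of ANY form MULTIPLICATIVE at `q` and congruent to `f` off `q` — and
every cusp `γ∞`, `γ ∈ Γ₀(N')`: `c·∏ℓ²·{∞, γ∞}_g ≡ c·((∏_{ℓ∈S}([1] + B'_ℓ[ℓ] + E'_ℓ[ℓ²]))·{∞, ·}_F)(γ∞) (mod 2Λ)`. Reason: mod `2` the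
`q`-Euler factor of `f` is `1 + V_q² = (1 + V_q)²`, one factor `1 + V_q` is `F`, the other is `≡ 1 + B'_q V_q`.
[cite: GreenbergVatsal2000, §3] [cite: EmertonPollackWeston2006, §3 (3.4)–(3.5)] [cite: CremonaAlgorithms1997, §2.4] -/
theorem oldLine_absorb
    {N L : ℕ} [NeZero N] {q : ℕ} (hq : q.Prime) (hqN : ¬ q ∣ N) (hL : L = N * q)
    (f : CuspForm (Gamma0 N) 2) (A : ℕ → ℤ) (hA : ∀ n, cuspCoeff f n = A n)
    (hT : ∀ (p : ℕ) (hp : p.Prime), (haveI : NeZero p := ⟨hp.ne_zero⟩; heckeT (Gamma0 N) 2 p f) = cuspCoeff f p • f)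
    (hqA : Even (A q))
    (S : Finset ℕ) (hS : ∀ ℓ ∈ S, ℓ.Prime) (hSodd : ∀ ℓ ∈ S, Odd ℓ) (hqS : q ∈ S)
    (B' E' : ℕ → ℤ) (hB' : ∀ ℓ ∈ S, ℓ ≠ q → (2 : ℤ) ∣ -A ℓ - B' ℓ)
    (hE' : ∀ ℓ ∈ S, ℓ ≠ q → (2 : ℤ) ∣ (if ℓ ∣ N then 0 else 1) - E' ℓ) (hB'q : Odd (B' q)) (hE'q : E' q = 0)
    (N' : ℕ) [NeZero N'] (hN' : L * ∏ ℓ ∈ S, ℓ ^ 2 ∣ N')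
    (g : CuspForm (Gamma0 N') 2) (hg : ∀ n, cuspCoeff g n = if ∃ ℓ ∈ S, ℓ ∣ n then 0 else cuspCoeff f n)
    (F : CuspForm (Gamma0 L) 2)
    (hF : ∀ n, cuspCoeff F n = cuspCoeff f n + (q : ℂ) * (if q ∣ n then cuspCoeff f (n / q) else 0))
    (Λ : AddSubgroup ℂ) (c : ℂ) (hc : ∀ z ∈ periodLattice f, c * z ∈ Λ)
    (γ : Gamma0 N') (hγ : (γ : SL(2, ℤ)) 1 0 ≠ 0) :
    ∃ z ∈ Λ, c * (((∏ ℓ ∈ S, ℓ ^ 2 : ℕ) : ℂ) *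
        modularSymbol g ((((γ : SL(2, ℤ)) 0 0 : ℚ) / ((γ : SL(2, ℤ)) 1 0 : ℚ)))) =
      c * ((∏ ℓ ∈ S, (MonoidAlgebra.single 1 (1 : ℂ) + MonoidAlgebra.single ℓ ((B' ℓ : ℤ) : ℂ) +
          MonoidAlgebra.single (ℓ ^ 2) ((E' ℓ : ℤ) : ℂ)) : MonoidAlgebra ℂ ℕ).coeff.sum
            fun m a ↦ a * modularSymbol F ((m : ℚ) * ((((γ : SL(2, ℤ)) 0 0 : ℚ) / ((γ : SL(2, ℤ)) 1 0 : ℚ))))) + 2 * z := by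
  classical
  subst hL
  haveI : NeZero q := ⟨hq.ne_zero⟩
  have hM0 : (∏ ℓ ∈ S, ℓ ^ 2) ≠ 0 := Finset.prod_ne_zero_iff.mpr fun ℓ hℓ ↦ pow_ne_zero 2 (hS ℓ hℓ).ne_zero
  set r : ℚ := (((γ : SL(2, ℤ)) 0 0 : ℚ) / ((γ : SL(2, ℤ)) 1 0 : ℚ)) with hr
  have hNM : N * ∏ ℓ ∈ S, ℓ ^ 2 ∣ N' := (Dvd.intro q (by ring) : N * ∏ ℓ ∈ S, ℓ ^ 2 ∣ N * q * ∏ ℓ ∈ S, ℓ ^ 2).trans hN'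
  have hMq : q ^ 2 * ∏ ℓ ∈ S.erase q, ℓ ^ 2 = ∏ ℓ ∈ S, ℓ ^ 2 := Finset.mul_prod_erase S (fun ℓ ↦ ℓ ^ 2) hqS
  -- `c·{∞, m r}_f ∈ Λ` for `m ∣ ∏ℓ²` (dilated cusps are `Γ₀(N)`-translates of `∞`)
  have hΛ : ∀ m : ℕ, m ∣ ∏ ℓ ∈ S, ℓ ^ 2 → c * modularSymbol f ((m : ℚ) * r) ∈ Λ := by
    intro m hm
    obtain ⟨δ, hδ, hδr⟩ := exists_gamma0_dilate_cusp (ne_zero_of_dvd_ne_zero hM0 hm) ((mul_dvd_mul_left N hm).trans hNM) γ hγ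
    have h : cuspSymbol f δ = modularSymbol f ((m : ℚ) * r) := by rw [cuspSymbol, if_neg hδ, hδr]
    rw [← h]
    exact hc _ (cuspSymbol_mem_periodLattice f δ)
  -- Step 1: the exact depleted period formula
  have hdep := modularSymbol_depleted_eq_act_of_dvd f hT S hS N' hNM g hg r
  -- Step 2: modulo `2Λ`, with the integer data `(0, 1)` at `q` and `(B', E')` off `q`
  have hℓ0 : ∀ ℓ ∈ S, (ℓ : ℂ) ≠ 0 := fun ℓ hℓ ↦ by exact_mod_cast (hS ℓ hℓ).ne_zero
  have hu : ∀ ℓ ∈ S, (ℓ : ℂ) * (-(cuspCoeff f ℓ) * (ℓ : ℂ)⁻¹) = ((-A ℓ : ℤ) : ℂ) := fun ℓ hℓ ↦ by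
    rw [hA, mul_comm, mul_assoc, inv_mul_cancel₀ (hℓ0 ℓ hℓ), mul_one, Int.cast_neg]
  have hv : ∀ ℓ ∈ S, (ℓ : ℂ) * (if ℓ ∣ N then 0 else (ℓ : ℂ)⁻¹) = ((if ℓ ∣ N then 0 else 1 : ℤ) : ℂ) := fun ℓ hℓ ↦ by
    split_ifs <;> simp [mul_inv_cancel₀ (hℓ0 ℓ hℓ)]
  have hB₁ : ∀ ℓ ∈ S, (2 : ℤ) ∣ -A ℓ - (if ℓ = q then 0 else B' ℓ) := by
    intro ℓ hℓ
    by_cases hℓq : ℓ = q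
    · subst hℓq
      rw [if_pos rfl, sub_zero]
      exact (even_neg.mpr hqA).two_dvd
    · rw [if_neg hℓq]
      exact hB' ℓ hℓ hℓq
  have hE₁ : ∀ ℓ ∈ S, (2 : ℤ) ∣ (if ℓ ∣ N then 0 else 1) - (if ℓ = q then 1 else E' ℓ) := by
    intro ℓ hℓ
    by_cases hℓq : ℓ = q
    · subst hℓq
      rw [if_neg hqN, if_pos rfl, sub_self]
      exact dvd_zero 2
    · rw [if_neg hℓq]
      exact hE' ℓ hℓ hℓq
  obtain ⟨z₁, hz₁, h₁⟩ := mul_act_prod_congr_mod_two Λ (modularSymbol f) c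
    (fun ℓ ↦ -(cuspCoeff f ℓ) * (ℓ : ℂ)⁻¹) (fun ℓ ↦ if ℓ ∣ N then 0 else (ℓ : ℂ)⁻¹)
    (fun ℓ ↦ -A ℓ) (fun ℓ ↦ if ℓ ∣ N then 0 else 1)
    (fun ℓ ↦ if ℓ = q then 0 else B' ℓ) (fun ℓ ↦ if ℓ = q then 1 else E' ℓ)
    S hSodd hu hv hB₁ hE₁ r hΛ
  -- Step 3: split off the `q`-factors
  set P : MonoidAlgebra ℂ ℕ := ∏ ℓ ∈ S.erase q, (MonoidAlgebra.single 1 (1 : ℂ) +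
    MonoidAlgebra.single ℓ ((B' ℓ : ℤ) : ℂ) + MonoidAlgebra.single (ℓ ^ 2) ((E' ℓ : ℤ) : ℂ)) with hP
  have hred₁ : (∏ ℓ ∈ S, (MonoidAlgebra.single 1 (1 : ℂ) + MonoidAlgebra.single ℓ (((if ℓ = q then 0 else B' ℓ : ℤ)) : ℂ) +
      MonoidAlgebra.single (ℓ ^ 2) (((if ℓ = q then 1 else E' ℓ : ℤ)) : ℂ)) : MonoidAlgebra ℂ ℕ) =
      (MonoidAlgebra.single 1 (1 : ℂ) + MonoidAlgebra.single q (0 : ℂ) + MonoidAlgebra.single (q ^ 2) (1 : ℂ)) * P := by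
    rw [← Finset.mul_prod_erase S _ hqS, if_pos rfl, if_pos rfl, Int.cast_zero, Int.cast_one, hP]
    congr 1
    refine Finset.prod_congr rfl fun ℓ hℓ ↦ ?_
    rw [if_neg (Finset.ne_of_mem_erase hℓ), if_neg (Finset.ne_of_mem_erase hℓ)]
  have hred₂ : (∏ ℓ ∈ S, (MonoidAlgebra.single 1 (1 : ℂ) + MonoidAlgebra.single ℓ ((B' ℓ : ℤ) : ℂ) +
      MonoidAlgebra.single (ℓ ^ 2) ((E' ℓ : ℤ) : ℂ)) : MonoidAlgebra ℂ ℕ) =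
      (MonoidAlgebra.single 1 (1 : ℂ) + MonoidAlgebra.single q ((B' q : ℤ) : ℂ) + MonoidAlgebra.single (q ^ 2) (0 : ℂ)) * P := by
    rw [← Finset.mul_prod_erase S _ hqS, hE'q, Int.cast_zero, hP]
  -- the modular symbols of the old line, and `q² r = q (q r)`
  have hΨ : (modularSymbol F : ℚ → ℂ) = fun s ↦ modularSymbol f s + modularSymbol f ((q : ℚ) * s) :=
    funext (modularSymbol_oldLine q f F hF)
  have hqq : (((q ^ 2 : ℕ) : ℚ) * r) = (q : ℚ) * ((q : ℚ) * r) := by push_cast; ring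
  rw [hred₂, act_factor_mul, hΨ]
  simp only [act_oldLine, zero_mul, add_zero]
  rw [hred₁, act_factor_mul, zero_mul, add_zero, one_mul] at h₁
  simp only [hqq] at h₁
  -- integrality of `cΦ(q r)` and `cΦ(q² r)`
  have hΛq : ∀ (j : ℕ), j ≤ 2 → ∀ m : ℕ, m ∣ ∏ ℓ ∈ S.erase q, ℓ ^ 2 →
      c * modularSymbol f ((m : ℚ) * (((q ^ j : ℕ) : ℚ) * r)) ∈ Λ := by
    intro j hj m hm
    have h := hΛ (m * q ^ j) (by rw [← hMq]; exact mul_comm (q ^ 2) _ ▸ mul_dvd_mul hm (pow_dvd_pow q hj))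
    simpa only [Nat.cast_mul, mul_assoc] using h
  have hΦ₁ : c * (P.coeff.sum fun m a ↦ a * modularSymbol f ((m : ℚ) * ((q : ℚ) * r))) ∈ Λ :=
    mul_act_prod_int_mem Λ (modularSymbol f) c _ _ (S.erase q) _ (by simpa only [pow_one] using hΛq 1 (by norm_num))
  have hΦ₂ : c * (P.coeff.sum fun m a ↦ a * modularSymbol f ((m : ℚ) * ((q : ℚ) * ((q : ℚ) * r)))) ∈ Λ := by
    have h := mul_act_prod_int_mem Λ (modularSymbol f) c B' E' (S.erase q) _ (hΛq 2 le_rfl)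
    simpa only [hqq] using h
  -- parity of `b = B'_q`
  obtain ⟨t, ht⟩ := hB'q
  have hb : ((B' q : ℤ) : ℂ) = 2 * (t : ℂ) + 1 := by rw [ht]; push_cast; ring
  refine ⟨z₁ - ((t : ℂ) + 1) * (c * (P.coeff.sum fun m a ↦ a * modularSymbol f ((m : ℚ) * ((q : ℚ) * r)))) -
      (t : ℂ) * (c * (P.coeff.sum fun m a ↦ a * modularSymbol f ((m : ℚ) * ((q : ℚ) * ((q : ℚ) * r))))), ?_, ?_⟩
  · refine Λ.sub_mem (Λ.sub_mem hz₁ ?_) ?_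
    · rw [show ((t : ℂ) + 1) = ((t + 1 : ℤ) : ℂ) by push_cast; ring, ← zsmul_eq_mul]; exact Λ.zsmul_mem hΦ₁ _
    · rw [← zsmul_eq_mul]; exact Λ.zsmul_mem hΦ₂ _
  · rw [hdep, hb]
    linear_combination h₁

/-! ## §2 THE REDUCTION: same half-kernel at the intermediate level `N₂ = N₁q` for `(F₁, f₂)` ⟹ same half-kernel of the `S`-depleted functionals -/

/-- **Cross-level same-kernel from the intermediate level (abstract lattices).** `f₁ ∈ S₂(Γ₀(N₁))`, `f₂ ∈ S₂(Γ₀(N₂))`, `N₂ = N₁q`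
(`q` prime, `q ∤ N₁`), Hecke eigenforms with integer coefficients `Aᵢ`, `a_q(f₁)` EVEN and `a_q(f₂)` ODD (the level-raising parities:
`E₁` good at `q` with `ρ̄(Frob_q)` unipotent, `E₂` multiplicative at `q`), `S ∋ q` a set of odd primes with `a_ℓ(f₁) ≡ a_ℓ(f₂) (mod 2)` for
`ℓ ≠ q`, `gᵢ` the `S`-depleted forms at a level `N'` with `N₂∏_{ℓ∈S}ℓ² ∣ N'`, `F₁ ∈ S₂(Γ₀(N₂))` the old line `f₁ + q·f₁(q·)`, `Λᵢ ⊇ cᵢΛ_{fᵢ}`.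
IF the half-kernels of `y ↦ c₁·y(F₁)` and `y ↦ c₂·y(f₂)` on `H₁(X₀(N₂);ℤ)` agree, THEN so do the half-kernels of the depleted functionals
`x ↦ cᵢ·∏ℓ²·x(gᵢ)` on `H₁(X₀(N');ℤ)`: both are `cᵢ·y(Hᵢ)` (`H₁ = F₁`, `H₂ = f₂`) modulo `2Λᵢ` for ONE cycle `y ∈ H₁(X₀(N₂);ℤ)`
(`oldLine_absorb` for `f₁` with the Euler data of `f₂`, `mul_act_prod_congr_mod_two` for `f₂`, `exists_mem_periodHomology_apply_eq_act`).
No alignment, Galois or multiplicity input. [cite: GreenbergVatsal2000, §3] [cite: EmertonPollackWeston2006, §3 (3.4)–(3.5)] [cite: CremonaAlgorithms1997, §2.4] -/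
theorem sameKernel_depleted_of_sameKernel_oldLine
    {N₁ N₂ : ℕ} [NeZero N₁] [NeZero N₂] {q : ℕ} (hq : q.Prime) (hqN₁ : ¬ q ∣ N₁) (hN₂ : N₂ = N₁ * q)
    (f₁ : CuspForm (Gamma0 N₁) 2) (f₂ : CuspForm (Gamma0 N₂) 2)
    (A₁ A₂ : ℕ → ℤ) (hA₁ : ∀ n, cuspCoeff f₁ n = A₁ n) (hA₂ : ∀ n, cuspCoeff f₂ n = A₂ n)
    (hT₁ : ∀ (p : ℕ) (hp : p.Prime), (haveI : NeZero p := ⟨hp.ne_zero⟩; heckeT (Gamma0 N₁) 2 p f₁) = cuspCoeff f₁ p • f₁)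
    (hT₂ : ∀ (p : ℕ) (hp : p.Prime), (haveI : NeZero p := ⟨hp.ne_zero⟩; heckeT (Gamma0 N₂) 2 p f₂) = cuspCoeff f₂ p • f₂)
    (hq₁ : Even (A₁ q)) (hq₂ : Odd (A₂ q))
    (S : Finset ℕ) (hS : ∀ ℓ ∈ S, ℓ.Prime) (hSodd : ∀ ℓ ∈ S, Odd ℓ) (hqS : q ∈ S)
    (hAS : ∀ ℓ ∈ S, ℓ ≠ q → (2 : ℤ) ∣ A₁ ℓ - A₂ ℓ)
    (N' : ℕ) [NeZero N'] (hN' : N₂ * ∏ ℓ ∈ S, ℓ ^ 2 ∣ N')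
    (g₁ g₂ : CuspForm (Gamma0 N') 2)
    (hg₁ : ∀ n, cuspCoeff g₁ n = if ∃ ℓ ∈ S, ℓ ∣ n then 0 else cuspCoeff f₁ n)
    (hg₂ : ∀ n, cuspCoeff g₂ n = if ∃ ℓ ∈ S, ℓ ∣ n then 0 else cuspCoeff f₂ n)
    (F₁ : CuspForm (Gamma0 N₂) 2)
    (hF₁ : ∀ n, cuspCoeff F₁ n = cuspCoeff f₁ n + (q : ℂ) * (if q ∣ n then cuspCoeff f₁ (n / q) else 0))
    (Λ₁ Λ₂ : AddSubgroup ℂ) (c₁ c₂ : ℂ)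
    (hc₁ : ∀ z ∈ periodLattice f₁, c₁ * z ∈ Λ₁) (hc₂ : ∀ z ∈ periodLattice f₂, c₂ * z ∈ Λ₂)
    (hker : ∀ y ∈ periodHomology N₂, c₁ * y F₁ / 2 ∈ Λ₁ ↔ c₂ * y f₂ / 2 ∈ Λ₂) :
    ∀ x ∈ periodHomology N',
      c₁ * (((∏ ℓ ∈ S, ℓ ^ 2 : ℕ) : ℂ) * x g₁) / 2 ∈ Λ₁ ↔ c₂ * (((∏ ℓ ∈ S, ℓ ^ 2 : ℕ) : ℂ) * x g₂) / 2 ∈ Λ₂ := by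
  classical
  subst hN₂
  haveI : NeZero q := ⟨hq.ne_zero⟩
  intro x hx
  have hM0 : (∏ ℓ ∈ S, ℓ ^ 2) ≠ 0 := Finset.prod_ne_zero_iff.mpr fun ℓ hℓ ↦ pow_ne_zero 2 (hS ℓ hℓ).ne_zero
  -- `x` is the period functional of one `γ ∈ Γ₀(N')`
  have hx' : x ∈ (periodHomology N' : Set (Module.Dual ℂ (CuspForm (Gamma0 N') 2))) := hx
  rw [coe_periodHomology_eq_range] at hx'
  obtain ⟨γ, rfl⟩ := hx'
  simp only [periodFunctional_apply]
  by_cases hγ : (γ : SL(2, ℤ)) 1 0 = 0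
  · simp only [cuspSymbol, if_pos hγ, mul_zero, zero_div, Λ₁.zero_mem, Λ₂.zero_mem]
  set r : ℚ := (((γ : SL(2, ℤ)) 0 0 : ℚ) / ((γ : SL(2, ℤ)) 1 0 : ℚ)) with hr
  have hcusp : ∀ g : CuspForm (Gamma0 N') 2, cuspSymbol g γ = modularSymbol g r := fun g ↦ by
    rw [cuspSymbol, if_neg hγ]
  rw [hcusp, hcusp]
  -- the `f₂`-side: clear the denominators of the Euler data modulo `2Λ₂`
  have hΛ₂ : ∀ m : ℕ, m ∣ ∏ ℓ ∈ S, ℓ ^ 2 → c₂ * modularSymbol f₂ ((m : ℚ) * r) ∈ Λ₂ := by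
    intro m hm
    obtain ⟨δ, hδ, hδr⟩ := exists_gamma0_dilate_cusp (ne_zero_of_dvd_ne_zero hM0 hm) ((mul_dvd_mul_left _ hm).trans hN') γ hγ
    have h : cuspSymbol f₂ δ = modularSymbol f₂ ((m : ℚ) * r) := by rw [cuspSymbol, if_neg hδ, hδr]
    rw [← h]
    exact hc₂ _ (cuspSymbol_mem_periodLattice f₂ δ)
  have hdep₂ := modularSymbol_depleted_eq_act_of_dvd f₂ hT₂ S hS N' hN' g₂ hg₂ r
  have hℓ0 : ∀ ℓ ∈ S, (ℓ : ℂ) ≠ 0 := fun ℓ hℓ ↦ by exact_mod_cast (hS ℓ hℓ).ne_zero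
  have hu₂ : ∀ ℓ ∈ S, (ℓ : ℂ) * (-(cuspCoeff f₂ ℓ) * (ℓ : ℂ)⁻¹) = ((-A₂ ℓ : ℤ) : ℂ) := fun ℓ hℓ ↦ by
    rw [hA₂, mul_comm, mul_assoc, inv_mul_cancel₀ (hℓ0 ℓ hℓ), mul_one, Int.cast_neg]
  have hv₂ : ∀ ℓ ∈ S, (ℓ : ℂ) * (if ℓ ∣ N₁ * q then 0 else (ℓ : ℂ)⁻¹) = ((if ℓ ∣ N₁ * q then 0 else 1 : ℤ) : ℂ) :=
    fun ℓ hℓ ↦ by split_ifs <;> simp [mul_inv_cancel₀ (hℓ0 ℓ hℓ)]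
  obtain ⟨z₂, hz₂, h₂⟩ := mul_act_prod_congr_mod_two Λ₂ (modularSymbol f₂) c₂
    (fun ℓ ↦ -(cuspCoeff f₂ ℓ) * (ℓ : ℂ)⁻¹) (fun ℓ ↦ if ℓ ∣ N₁ * q then 0 else (ℓ : ℂ)⁻¹)
    (fun ℓ ↦ -A₂ ℓ) (fun ℓ ↦ if ℓ ∣ N₁ * q then 0 else 1)
    (fun ℓ ↦ -A₂ ℓ) (fun ℓ ↦ if ℓ ∣ N₁ * q then 0 else 1)
    S hSodd hu₂ hv₂ (fun ℓ _ ↦ by simp) (fun ℓ _ ↦ by simp) r hΛ₂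
  -- the `f₁`-side: absorption through `F₁` with the Euler data of `f₂`
  have hB' : ∀ ℓ ∈ S, ℓ ≠ q → (2 : ℤ) ∣ -A₁ ℓ - -A₂ ℓ := fun ℓ hℓ hℓq ↦ by
    rw [show -A₁ ℓ - -A₂ ℓ = -(A₁ ℓ - A₂ ℓ) by ring]
    exact (hAS ℓ hℓ hℓq).neg_right
  have hE' : ∀ ℓ ∈ S, ℓ ≠ q → (2 : ℤ) ∣ (if ℓ ∣ N₁ then 0 else 1) - (if ℓ ∣ N₁ * q then 0 else 1 : ℤ) := by
    intro ℓ hℓ hℓq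
    have hiff : ℓ ∣ N₁ * q ↔ ℓ ∣ N₁ := by
      refine ⟨fun h ↦ ?_, fun h ↦ h.mul_right q⟩
      rcases (Nat.Prime.dvd_mul (hS ℓ hℓ)).mp h with h | h
      · exact h
      · exact absurd ((Nat.prime_dvd_prime_iff_eq (hS ℓ hℓ) hq).mp h) hℓq
    by_cases hℓN : ℓ ∣ N₁
    · rw [if_pos hℓN, if_pos (hiff.mpr hℓN), sub_self]; exact dvd_zero 2
    · rw [if_neg hℓN, if_neg (fun h ↦ hℓN (hiff.mp h)), sub_self]; exact dvd_zero 2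
  obtain ⟨z₁, hz₁, h₁⟩ := oldLine_absorb hq hqN₁ rfl f₁ A₁ hA₁ hT₁ hq₁ S hS hSodd hqS (fun ℓ ↦ -A₂ ℓ)
    (fun ℓ ↦ if ℓ ∣ N₁ * q then 0 else 1) hB' hE' hq₂.neg (if_pos (dvd_mul_left q N₁)) N' hN' g₁ hg₁ F₁ hF₁ Λ₁ c₁ hc₁ γ hγ
  -- ONE cycle `y ∈ H₁(X₀(N₁q);ℤ)` computing the common integer operator on every form of level `N₁q`
  obtain ⟨y, hy, hyH⟩ := exists_mem_periodHomology_apply_eq_act (N₁ * q) (fun ℓ ↦ -A₂ ℓ)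
    (fun ℓ ↦ if ℓ ∣ N₁ * q then 0 else 1) S r (fun m hm ↦
      exists_gamma0_dilate_cusp (ne_zero_of_dvd_ne_zero hM0 hm) ((mul_dvd_mul_left _ hm).trans hN') γ hγ)
  have E1 : c₁ * (((∏ ℓ ∈ S, ℓ ^ 2 : ℕ) : ℂ) * modularSymbol g₁ r) = c₁ * y F₁ + 2 * z₁ := by rw [hyH F₁]; exact h₁
  have E2 : c₂ * (((∏ ℓ ∈ S, ℓ ^ 2 : ℕ) : ℂ) * modularSymbol g₂ r) = c₂ * y f₂ + 2 * z₂ := by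
    rw [hdep₂, hyH f₂]
    linear_combination h₂
  rw [div_two_mem_iff_of_eq_add Λ₁ hz₁ E1, div_two_mem_iff_of_eq_add Λ₂ hz₂ E2]
  exact hker y hy

/-! ## §3 The reduction in the crux's currency (`ModularParametrizationData`, `uniformize`) -/

/-- **The cross-level hypothesis of (R2) for `N(W₂) = q·N(W₁)`, from the intermediate level.** For parametrisation data `D₁`
(level `N₁`) and `D₂` (level `N₂ = N₁q`, `q` prime, `q ∤ N₁`), `a_q(W₁)` even and `a_q(W₂)` odd, `S ∋ q` a set of odd primes with
`a_ℓ(W₁) ≡ a_ℓ(W₂) (mod 2)` for `ℓ ∈ S ∖ {q}`, the `S`-depleted forms `g₁ g₂` at a level `N'` with `N₂∏ℓ² ∣ N'`, and the old line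
`F₁ = f₁ + q·f₁(q·) ∈ S₂(Γ₀(N₂))`: IF `u₁(c₁·y(F₁)/2) = O ↔ u₂(c₂·y(f₂)/2) = O` for every cycle `y ∈ H₁(X₀(N₂);ℤ)` (same half-kernel at
level `N₂` — «the old `E₁`-plane and the `E₂`-plane of `J₀(N₂)[2]` have the same orthogonal»), THEN
`u₁(c₁·∏ℓ²·x(g₁)/2) = O ↔ u₂(c₂·∏ℓ²·x(g₂)/2) = O` for every `x ∈ H₁(X₀(N');ℤ)` — the conclusion of the inline cross-level stub of line `birth`
(v26 `stub_sameDepletedCopyKilford` / v27 `stub_sameDepletedCopyKilfordNe`, hypothesis `hCopy` of `…KilfordCopyOfPrint.lamLawKilford_of_facts`) for this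
pair, with `S = primeFactors(N₁N₂) ∖ {2}` and `N' = N₁N₂∏ℓ²`. [cite: GreenbergVatsal2000, §3] [cite: EmertonPollackWeston2006, §3 (3.4)–(3.5)]
[cite: CremonaAlgorithms1997, §2.4 and §2.10] -/
theorem uniformize_depleted_iff_of_oldLine
    {W₁ W₂ : WeierstrassCurve ℚ} {N₁ N₂ : ℕ} [NeZero N₁] [NeZero N₂]
    (D₁ : ModularParametrizationData W₁ N₁) (D₂ : ModularParametrizationData W₂ N₂)
    {q : ℕ} (hq : q.Prime) (hqN₁ : ¬ q ∣ N₁) (hN₂ : N₂ = N₁ * q)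
    (hq₁ : Even (W₁.LFunction q)) (hq₂ : Odd (W₂.LFunction q))
    (S : Finset ℕ) (hS : ∀ ℓ ∈ S, ℓ.Prime) (hSodd : ∀ ℓ ∈ S, Odd ℓ) (hqS : q ∈ S)
    (hAS : ∀ ℓ ∈ S, ℓ ≠ q → (2 : ℤ) ∣ W₁.LFunction ℓ - W₂.LFunction ℓ)
    (N' : ℕ) [NeZero N'] (hN' : N₂ * ∏ ℓ ∈ S, ℓ ^ 2 ∣ N')
    (g₁ g₂ : CuspForm (Gamma0 N') 2)
    (hg₁ : ∀ n, cuspCoeff g₁ n = if ∃ ℓ ∈ S, ℓ ∣ n then 0 else cuspCoeff D₁.f n)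
    (hg₂ : ∀ n, cuspCoeff g₂ n = if ∃ ℓ ∈ S, ℓ ∣ n then 0 else cuspCoeff D₂.f n)
    (F₁ : CuspForm (Gamma0 N₂) 2)
    (hF₁ : ∀ n, cuspCoeff F₁ n = cuspCoeff D₁.f n + (q : ℂ) * (if q ∣ n then cuspCoeff D₁.f (n / q) else 0))
    (hker : ∀ y ∈ periodHomology N₂,
      D₁.uniformize ((D₁.c : ℂ) * y F₁ / 2) = 0 ↔ D₂.uniformize ((D₂.c : ℂ) * y D₂.f / 2) = 0) :
    ∀ x ∈ periodHomology N',
      D₁.uniformize ((D₁.c : ℂ) * ((((∏ ℓ ∈ S, ℓ ^ 2 : ℕ) : ℂ) * x g₁) / 2)) = 0 ↔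
        D₂.uniformize ((D₂.c : ℂ) * ((((∏ ℓ ∈ S, ℓ ^ 2 : ℕ) : ℂ) * x g₂) / 2)) = 0 := by
  intro x hx
  rw [D₁.uniformize_eq_zero_iff, D₂.uniformize_eq_zero_iff, ← mul_div_assoc, ← mul_div_assoc]
  have hT₁ : ∀ (p : ℕ) (hp : p.Prime), (haveI : NeZero p := ⟨hp.ne_zero⟩; heckeT (Gamma0 N₁) 2 p D₁.f) = cuspCoeff D₁.f p • D₁.f :=
    fun p hp ↦ by haveI : NeZero p := ⟨hp.ne_zero⟩; exact D₁.isNewformOf.1.heckeT_eq_coeff_smul hp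
  have hT₂ : ∀ (p : ℕ) (hp : p.Prime), (haveI : NeZero p := ⟨hp.ne_zero⟩; heckeT (Gamma0 N₂) 2 p D₂.f) = cuspCoeff D₂.f p • D₂.f :=
    fun p hp ↦ by haveI : NeZero p := ⟨hp.ne_zero⟩; exact D₂.isNewformOf.1.heckeT_eq_coeff_smul hp
  have hker' : ∀ y ∈ periodHomology N₂,
      (D₁.c : ℂ) * y F₁ / 2 ∈ D₁.L.lattice.toAddSubgroup ↔ (D₂.c : ℂ) * y D₂.f / 2 ∈ D₂.L.lattice.toAddSubgroup := by
    intro y hy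
    rw [Submodule.mem_toAddSubgroup, Submodule.mem_toAddSubgroup, ← D₁.uniformize_eq_zero_iff, ← D₂.uniformize_eq_zero_iff]
    exact hker y hy
  exact sameKernel_depleted_of_sameKernel_oldLine hq hqN₁ hN₂ D₁.f D₂.f (fun n ↦ W₁.LFunction n) (fun n ↦ W₂.LFunction n)
    D₁.isNewformOf.2 D₂.isNewformOf.2 hT₁ hT₂ hq₁ hq₂ S hS hSodd hqS hAS N' hN' g₁ g₂ hg₁ hg₂ F₁ hF₁
    D₁.L.lattice.toAddSubgroup D₂.L.lattice.toAddSubgroup D₁.c D₂.c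
    (fun z hz ↦ D₁.smul_periodLattice_le z hz) (fun z hz ↦ D₂.smul_periodLattice_le z hz) hker' x hx


/-! ## §4 The parity side conditions along `N₂ = N₁q` from the reduction types; the reduction with ONE parity hypothesis left -/
/-- **`W₂` is multiplicative at `q` when `N(W₂) = N₁·q` with `q ∤ N₁`**, hence `a_q(W₂)` is ODD (`a_q = ±1`). [cite: Silverman1994, IV.10.2 (b)] -/
theorem odd_LFunction_of_conductorNorm_eq_mul (W₂ : WeierstrassCurve ℚ) [W₂.IsElliptic] {N₁ q : ℕ} (hq : q.Prime)
    (hqN₁ : ¬ q ∣ N₁) (hN₂ : W₂.conductorNorm ℤ = N₁ * q) : Odd (W₂.LFunction q) := by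
  haveI : Fact q.Prime := ⟨hq⟩
  have hqN₂ : q ∣ W₂.conductorNorm ℤ := by rw [hN₂]; exact Dvd.intro_left _ rfl
  rw [odd_LFunction_iff_hasMultiplicativeReductionAtPrime W₂ hq hqN₂,
    W₂.hasMultiplicativeReductionAtPrime_iff_hasMultiplicativeReductionAt_holds ⟨q, hq⟩]
  set v : HeightOneSpectrum ℤ := (Rat.HeightOneSpectrum.primesEquiv (R := ℤ)).symm ⟨q, hq⟩ with hv
  have hgen : Rat.HeightOneSpectrum.natGenerator v = q :=
    congrArg Subtype.val ((Rat.HeightOneSpectrum.primesEquiv (R := ℤ)).apply_symm_apply ⟨q, hq⟩)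
  have hbad : ¬ W₂.HasGoodReductionAt v := (natGenerator_dvd_conductorNorm_iff v W₂).mp (hgen ▸ hqN₂)
  have hnadd : ¬ W₂.HasAdditiveReductionAt v := by
    intro h
    have h2 := (natGenerator_sq_dvd_conductorNorm_iff v W₂).mpr h
    rw [hgen, hN₂, pow_two] at h2
    exact hqN₁ (Nat.dvd_of_mul_dvd_mul_right hq.pos h2)
  rcases hasGoodReductionAt_or_hasMultiplicativeReductionAt_or_hasAdditiveReductionAt v W₂ with h | h | h
  · exact (hbad h).elim
  · exact h
  · exact (hnadd h).elim

/-- **Same reduction type at `ℓ ∣ N₁`, `ℓ ≠ q`, when `N(W₁) = N₁` and `N(W₂) = N₁·q`**: the conductor exponents at `ℓ` agree, so both curves are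
multiplicative (`a_ℓ = ±1`) or both additive (`a_ℓ = 0`) there; hence `a_ℓ(W₁) ≡ a_ℓ(W₂) (mod 2)`. [cite: Silverman1994, IV.10.2] -/
theorem two_dvd_LFunction_sub_of_conductorNorm_eq_mul (W₁ W₂ : WeierstrassCurve ℚ) [W₁.IsElliptic] [W₂.IsElliptic] {q : ℕ}
    (hq : q.Prime) (hN₂ : W₂.conductorNorm ℤ = W₁.conductorNorm ℤ * q) {ℓ : ℕ} (hℓ : ℓ.Prime) (hℓq : ℓ ≠ q)
    (hℓN : ℓ ∣ W₁.conductorNorm ℤ) : (2 : ℤ) ∣ W₁.LFunction ℓ - W₂.LFunction ℓ := by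
  haveI : Fact ℓ.Prime := ⟨hℓ⟩
  have hℓN₂ : ℓ ∣ W₂.conductorNorm ℤ := by rw [hN₂]; exact hℓN.mul_right q
  have hcop : Nat.Coprime (ℓ ^ 2) q := ((Nat.coprime_primes hℓ hq).mpr hℓq).pow_left 2
  set v : HeightOneSpectrum ℤ := (Rat.HeightOneSpectrum.primesEquiv (R := ℤ)).symm ⟨ℓ, hℓ⟩ with hv
  have hgen : Rat.HeightOneSpectrum.natGenerator v = ℓ :=
    congrArg Subtype.val ((Rat.HeightOneSpectrum.primesEquiv (R := ℤ)).apply_symm_apply ⟨ℓ, hℓ⟩)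
  have hbad₁ : ¬ W₁.HasGoodReductionAt v := (natGenerator_dvd_conductorNorm_iff v W₁).mp (hgen ▸ hℓN)
  have hbad₂ : ¬ W₂.HasGoodReductionAt v := (natGenerator_dvd_conductorNorm_iff v W₂).mp (hgen ▸ hℓN₂)
  have hadd : W₁.HasAdditiveReductionAt v ↔ W₂.HasAdditiveReductionAt v := by
    rw [← natGenerator_sq_dvd_conductorNorm_iff v W₁, ← natGenerator_sq_dvd_conductorNorm_iff v W₂, hN₂, hgen]
    exact ⟨fun h ↦ h.mul_right q, fun h ↦ hcop.dvd_of_dvd_mul_right h⟩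
  have hmul : W₁.HasMultiplicativeReductionAtPrime ℓ ↔ W₂.HasMultiplicativeReductionAtPrime ℓ := by
    rw [W₁.hasMultiplicativeReductionAtPrime_iff_hasMultiplicativeReductionAt_holds ⟨ℓ, hℓ⟩,
      W₂.hasMultiplicativeReductionAtPrime_iff_hasMultiplicativeReductionAt_holds ⟨ℓ, hℓ⟩]
    constructor
    · intro h₁
      rcases hasGoodReductionAt_or_hasMultiplicativeReductionAt_or_hasAdditiveReductionAt v W₂ with h | h | h
      · exact (hbad₂ h).elim
      · exact h
      · exact (h₁.not_hasAdditiveReductionAt (hadd.mpr h)).elim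
    · intro h₂
      rcases hasGoodReductionAt_or_hasMultiplicativeReductionAt_or_hasAdditiveReductionAt v W₁ with h | h | h
      · exact (hbad₁ h).elim
      · exact h
      · exact (h₂.not_hasAdditiveReductionAt (hadd.mp h)).elim
  have h₁ := odd_LFunction_iff_hasMultiplicativeReductionAtPrime W₁ hℓ hℓN
  have h₂ := odd_LFunction_iff_hasMultiplicativeReductionAtPrime W₂ hℓ hℓN₂
  have heven : Even (W₁.LFunction ℓ - W₂.LFunction ℓ) := by
    rw [Int.even_sub, ← Int.not_odd_iff_even, ← Int.not_odd_iff_even, h₁, h₂, hmul]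
  exact heven.two_dvd

/-- **The cross-level hypothesis of (R2) at the conductor levels, `N(W₂) = q·N(W₁)`, with the reduction-type parities DISCHARGED.** As
`uniformize_depleted_iff_of_oldLine` with `N₁ = N(W₁)`, `N₂ = N(W₂) = N(W₁)·q` and `S ∖ {q} ⊆ primes of N(W₁)` (the case of the line:
`S = primeFactors(N₁N₂) ∖ {2}`): `a_q(W₂)` odd and `a_ℓ(W₁) ≡ a_ℓ(W₂)` on `S ∖ q` now FOLLOW from the conductors
(`odd_LFunction_of_conductorNorm_eq_mul`, `two_dvd_LFunction_sub_of_conductorNorm_eq_mul`); the ONE remaining parity hypothesis is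
`a_q(W₁)` EVEN — in print: Kraus–Oesterlé 1992 Prop. 3 (i) ⇒ (iii), second clause («`a_ℓ a'_ℓ ≡ ℓ + 1 (mod p)` for `ℓ ∥ NN'`», at `p = 2`:
`a_q(W₁)·(±1) ≡ q + 1 ≡ 0`), a consequence of `W₁[2] ≅ W₂[2]` via the Tate curve at `q`; not proved in the tree (its `KrausOesterle1992/` story
proves the good-prime clause only), decidable per pair. [cite: KrausOesterle1992, Prop. 3 (p. 262–263)] [cite: Silverman1994, IV.10.2]
[cite: GreenbergVatsal2000, §3] [cite: CremonaAlgorithms1997, §2.4 and §2.10] -/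
theorem uniformize_depleted_iff_of_oldLine_conductor
    {W₁ W₂ : WeierstrassCurve ℚ} [W₁.IsElliptic] [W₂.IsElliptic] [NeZero (W₁.conductorNorm ℤ)] [NeZero (W₂.conductorNorm ℤ)]
    (D₁ : ModularParametrizationData W₁ (W₁.conductorNorm ℤ)) (D₂ : ModularParametrizationData W₂ (W₂.conductorNorm ℤ))
    {q : ℕ} (hq : q.Prime) (hqN₁ : ¬ q ∣ W₁.conductorNorm ℤ) (hN₂ : W₂.conductorNorm ℤ = W₁.conductorNorm ℤ * q)
    (hq₁ : Even (W₁.LFunction q))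
    (S : Finset ℕ) (hS : ∀ ℓ ∈ S, ℓ.Prime) (hSodd : ∀ ℓ ∈ S, Odd ℓ) (hqS : q ∈ S)
    (hSN : ∀ ℓ ∈ S, ℓ ≠ q → ℓ ∣ W₁.conductorNorm ℤ)
    (N' : ℕ) [NeZero N'] (hN' : W₂.conductorNorm ℤ * ∏ ℓ ∈ S, ℓ ^ 2 ∣ N')
    (g₁ g₂ : CuspForm (Gamma0 N') 2)
    (hg₁ : ∀ n, cuspCoeff g₁ n = if ∃ ℓ ∈ S, ℓ ∣ n then 0 else cuspCoeff D₁.f n)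
    (hg₂ : ∀ n, cuspCoeff g₂ n = if ∃ ℓ ∈ S, ℓ ∣ n then 0 else cuspCoeff D₂.f n)
    (F₁ : CuspForm (Gamma0 (W₂.conductorNorm ℤ)) 2)
    (hF₁ : ∀ n, cuspCoeff F₁ n = cuspCoeff D₁.f n + (q : ℂ) * (if q ∣ n then cuspCoeff D₁.f (n / q) else 0))
    (hker : ∀ y ∈ periodHomology (W₂.conductorNorm ℤ),
      D₁.uniformize ((D₁.c : ℂ) * y F₁ / 2) = 0 ↔ D₂.uniformize ((D₂.c : ℂ) * y D₂.f / 2) = 0) :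
    ∀ x ∈ periodHomology N',
      D₁.uniformize ((D₁.c : ℂ) * ((((∏ ℓ ∈ S, ℓ ^ 2 : ℕ) : ℂ) * x g₁) / 2)) = 0 ↔
        D₂.uniformize ((D₂.c : ℂ) * ((((∏ ℓ ∈ S, ℓ ^ 2 : ℕ) : ℂ) * x g₂) / 2)) = 0 :=
  uniformize_depleted_iff_of_oldLine D₁ D₂ hq hqN₁ hN₂ hq₁ (odd_LFunction_of_conductorNorm_eq_mul W₂ hq hqN₁ hN₂) S hS hSodd hqS
    (fun ℓ hℓ hℓq ↦ two_dvd_LFunction_sub_of_conductorNorm_eq_mul W₁ W₂ hq hN₂ (hS ℓ hℓ) hℓq (hSN ℓ hℓ hℓq)) N' hN' g₁ g₂ hg₁ hg₂ F₁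
    hF₁ hker

end Summit.BirchSwinnertonDyer.BirchSwinnertonDyer.Theorems.AlignedTransportAtTwoKilfordCopyCrossLevel

end
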